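/-
Solo-blind programme (Kontsevich–Zagier periods), session s18.
-/
import Summits.KontsevichZagierPeriods.KontsevichZagierPeriods.Theorems.SoloBlindPolylogLadder

/-!
# Depth two at the base point `−1`: the corner-bracket lemmas

Pure matrix algebra over a commutative ring: the kernel of the paper-level THEOREM D.21
(`hodge.md` §8.11 of the solo-blind notes), which is NOT formalised here and is only context.

Context (paper level).  For the word `e = 1 0^{a−1} 1 0^{b−1}` (`w = a + b`) the iterated-integral
Hodge–Tate structure `M_e(−1)` has rank `w + 1` and top period `Li_{a,b}(−1) = Σ_{0<m<n} (−1)ⁿ/(mᵃnᵇ)`.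
The graded conjugate `𝔲⁰` of the Lie algebra of the unipotent radical of its Mumford–Tate group sits in
the strictly upper triangular `(w+1) × (w+1)` matrices; its elements vanish on the diagonal blocks of the
zero sub-words, it projects onto the odd corners `E a (a+p)` of the two polylogarithm blocks, and it is
exact in degree one, spanned by `X = E 0 1 + E a (a+1)` (the two `log 2` slots).  The identities below
turn those facts into the new corner direction `E 0 w` (a bracket of two lifted block corners) and into
the corner vanishing of the `ad X`-iterates used for the Jacobian.  Nothing about periods, Hodge theory
or the Kontsevich–Zagier statement is claimed in this file.

Main statements (ambient size `n + 2`, last index `w` with `(w : ℕ) = n + 1`):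
* `lie_homog_corner`     : `A` homogeneous of degree `a`, `B` of degree `b`, `a + b = n + 1` ⟹
                           `⁅A, B⁆ = (A 0 a * B a w − B 0 b * A b w) • E 0 w`;
* `corner_of_block_lifts`: hence `⁅A, B⁆ = E 0 w` when `A 0 a = 1`, `B a w = 1`, `A b w = 0`;
* `lie_homog_eq_zero`    : and `⁅A, B⁆ = 0` when `B a w = 0`, `A b w = 0` (off-diagonal vanishing);
* `lie_X_apply`, `lie_X_corner`, `lie_X_row_one`, `lie_X1_rows` : entries of `⁅E 0 1 + E a a', Y⁆`;
* `iter_lie_X_corner` (`a ≥ 2`) and `iter_lie_X1_corner` (`a = 1`): every iterate `(ad X)^{j+2} Y`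
  has zero `(0, w)` entry, for `Y` strictly upper triangular with `Y 1 a = 0`
  (resp. with zero rows `≥ 2`).
-/

namespace Summit.KontsevichZagierPeriods.KontsevichZagierPeriods.Theorems

namespace SoloBlind

namespace DepthTwo

open Matrix PolylogLadder

variable {K : Type*} [CommRing K] {n : ℕ}

local notation "𝕄" => Matrix (Fin (n + 2)) (Fin (n + 2)) K

/-! ## Products with a matrix unit, entrywise -/

/-- `(E p q * Y) i k = [i = p] · Y q k`. -/
theorem E_mul_apply (p q : Fin (n + 2)) (Y : 𝕄) (i k : Fin (n + 2)) :
    (E K p q * Y) i k = if i = p then Y q k else 0 := by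
  rw [Matrix.mul_apply]
  split_ifs with h
  · rw [Finset.sum_eq_single q]
    · simp [E_apply, h]
    · intro l _ hl
      simp [E_apply, hl]
    · intro hq
      exact absurd (Finset.mem_univ q) hq
  · apply Finset.sum_eq_zero
    intro l _
    simp [E_apply, h]

/-- `(Y * E p q) i k = [k = q] · Y i p`. -/
theorem mul_E_apply (p q : Fin (n + 2)) (Y : 𝕄) (i k : Fin (n + 2)) :
    (Y * E K p q) i k = if k = q then Y i p else 0 := by
  rw [Matrix.mul_apply]
  split_ifs with h
  · rw [Finset.sum_eq_single p]
    · simp [E_apply, h]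
    · intro l _ hl
      simp [E_apply, hl]
    · intro hp
      exact absurd (Finset.mem_univ p) hp
  · apply Finset.sum_eq_zero
    intro l _
    simp [E_apply, h]

/-! ## The corner bracket of two homogeneous elements -/

/-- If `A` is homogeneous of degree `a` (supported on the `a`-th superdiagonal) and `B` of degree `b`
with `a + b = n + 1 = w` (the last index), then `⁅A, B⁆ = (A 0 a * B a w − B 0 b * A b w) • E 0 w`. -/
theorem lie_homog_corner (a b w : Fin (n + 2)) (hw : (w : ℕ) = n + 1) (hab : (a : ℕ) + b = n + 1)
    (A B : 𝕄) (hA : ∀ i j : Fin (n + 2), (j : ℕ) ≠ i + a → A i j = 0)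
    (hB : ∀ i j : Fin (n + 2), (j : ℕ) ≠ i + b → B i j = 0) :
    ⁅A, B⁆ = (A 0 a * B a w - B 0 b * A b w) • (E K 0 w : 𝕄) := by
  -- the generic entry of a product of two homogeneous matrices of total degree `n + 1`
  have key : ∀ (C D : 𝕄) (c d : Fin (n + 2)), (c : ℕ) + d = n + 1 →
      (∀ i j : Fin (n + 2), (j : ℕ) ≠ i + c → C i j = 0) →
      (∀ i j : Fin (n + 2), (j : ℕ) ≠ i + d → D i j = 0) →
      ∀ i j : Fin (n + 2), ¬ (i = 0 ∧ j = w) → ∑ l, C i l * D l j = 0 := by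
    intro C D c d hcd hC hD i j hij
    apply Finset.sum_eq_zero
    intro l _
    by_cases h1 : (l : ℕ) = i + c
    · by_cases h2 : (j : ℕ) = l + d
      · exfalso
        apply hij
        have hj := j.isLt
        refine ⟨Fin.ext ?_, Fin.ext ?_⟩
        · simp only [Fin.val_zero]; omega
        · rw [hw]; omega
      · rw [hD l j h2, mul_zero]
    · rw [hC i l h1, zero_mul]
  ext i j
  rw [Ring.lie_def, Matrix.sub_apply, Matrix.mul_apply, Matrix.mul_apply, Matrix.smul_apply,
    E_apply]
  by_cases hij : i = 0 ∧ j = w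
  · obtain ⟨hi0, hjw⟩ := hij
    subst hi0
    rw [hjw]
    have hs1 : ∑ l, A 0 l * B l w = A 0 a * B a w := by
      rw [Finset.sum_eq_single a]
      · intro l _ hl
        rw [hA 0 l ?_, zero_mul]
        intro h
        apply hl
        exact Fin.ext (by simpa using h)
      · intro h
        exact absurd (Finset.mem_univ a) h
    have hs2 : ∑ l, B 0 l * A l w = B 0 b * A b w := by
      rw [Finset.sum_eq_single b]
      · intro l _ hl
        rw [hB 0 l ?_, zero_mul]
        intro h
        apply hl
        exact Fin.ext (by simpa using h)
      · intro h
        exact absurd (Finset.mem_univ b) h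
    rw [hs1, hs2]
    simp
  · rw [key A B a b hab hA hB i j hij, key B A b a (by omega) hB hA i j hij]
    simp [hij]

/-- The bracket of two LIFTED BLOCK CORNERS is the new corner: if `A` (degree `a`) has `A 0 a = 1`
(lift of the corner of the block `[0, a]`), `B` (degree `b`) has `B a w = 1` (lift of the corner of
the block `[a, w]`) and `A b w = 0` (the entry `(b, w)` lies in the zero block `[a+1, w]` when
`a < b`), then `⁅A, B⁆ = E 0 w`. -/
theorem corner_of_block_lifts (a b w : Fin (n + 2)) (hw : (w : ℕ) = n + 1)
    (hab : (a : ℕ) + b = n + 1) (A B : 𝕄)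
    (hA : ∀ i j : Fin (n + 2), (j : ℕ) ≠ i + a → A i j = 0)
    (hB : ∀ i j : Fin (n + 2), (j : ℕ) ≠ i + b → B i j = 0)
    (hA0 : A 0 a = 1) (hBa : B a w = 1) (hAb : A b w = 0) :
    ⁅A, B⁆ = (E K 0 w : 𝕄) := by
  rw [lie_homog_corner a b w hw hab A B hA hB, hA0, hBa, hAb]
  simp

/-- Off-diagonal vanishing used for the triangular Jacobian: if moreover `B a w = 0` and `A b w = 0`
(on the structure of ANOTHER word both relevant entries lie in a zero block), then `⁅A, B⁆ = 0`. -/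
theorem lie_homog_eq_zero (a b w : Fin (n + 2)) (hw : (w : ℕ) = n + 1)
    (hab : (a : ℕ) + b = n + 1) (A B : 𝕄)
    (hA : ∀ i j : Fin (n + 2), (j : ℕ) ≠ i + a → A i j = 0)
    (hB : ∀ i j : Fin (n + 2), (j : ℕ) ≠ i + b → B i j = 0)
    (hBa : B a w = 0) (hAb : A b w = 0) :
    ⁅A, B⁆ = 0 := by
  rw [lie_homog_corner a b w hw hab A B hA hB, hBa, hAb]
  simp

/-! ## Brackets with the exact degree-one element `X = E 0 1 + E a a'` -/

/-- Entries of `⁅E 0 1 + E a a', Y⁆`. -/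
theorem lie_X_apply (a a1 : Fin (n + 2)) (Y : 𝕄) (i k : Fin (n + 2)) :
    ⁅(E K 0 1 + E K a a1 : 𝕄), Y⁆ i k =
      (if i = 0 then Y 1 k else 0) + (if i = a then Y a1 k else 0)
        - (if k = 1 then Y i 0 else 0) - (if k = a1 then Y i a else 0) := by
  rw [Ring.lie_def, Matrix.sub_apply, add_mul, mul_add, Matrix.add_apply, Matrix.add_apply,
    E_mul_apply, E_mul_apply, mul_E_apply, mul_E_apply]
  abel

/-- The corner of `⁅X, Y⁆` is the entry `Y 1 w` (for `a ≠ 0`, `w ≠ 1`, `w ≠ a'`). -/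
theorem lie_X_corner (a a1 w : Fin (n + 2)) (ha : a ≠ 0) (hw1 : w ≠ 1) (hwa : w ≠ a1) (Y : 𝕄) :
    ⁅(E K 0 1 + E K a a1 : 𝕄), Y⁆ 0 w = Y 1 w := by
  rw [lie_X_apply]
  simp [Ne.symm ha, hw1, hwa]

/-- Row `1` of `⁅X, Y⁆` vanishes as soon as `Y 1 0 = Y 1 a = 0` (case `a ≠ 1`). -/
theorem lie_X_row_one (a a1 : Fin (n + 2)) (ha1 : a ≠ 1) (Y : 𝕄) (h10 : Y 1 0 = 0)
    (h1a : Y 1 a = 0) (k : Fin (n + 2)) :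
    ⁅(E K 0 1 + E K a a1 : 𝕄), Y⁆ 1 k = 0 := by
  have h01 : (1 : Fin (n + 2)) ≠ 0 := (Fin.zero_lt_one : (0 : Fin (n + 2)) < 1).ne'
  rw [lie_X_apply]
  simp [h01, Ne.symm ha1, h10, h1a]

/-- Case `a = 1` (`X = E 0 1 + E 1 2`): if `Y` is strictly upper triangular with zero rows `≥ 2`,
then all rows `≥ 1` of `⁅X, Y⁆` vanish. -/
theorem lie_X1_rows (i2 : Fin (n + 2)) (hi2 : (i2 : ℕ) = 2) (Y : 𝕄) (hY : Drop 1 Y)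
    (hrows : ∀ i k : Fin (n + 2), 2 ≤ (i : ℕ) → Y i k = 0) (i k : Fin (n + 2))
    (hi : 1 ≤ (i : ℕ)) :
    ⁅(E K 0 1 + E K 1 i2 : 𝕄), Y⁆ i k = 0 := by
  have h01 : (1 : Fin (n + 2)) ≠ 0 := (Fin.zero_lt_one : (0 : Fin (n + 2)) < 1).ne'
  have hi0 : i ≠ 0 := by
    intro h
    rw [h] at hi
    simp at hi
  have hY0 : Y i 0 = 0 := hY i 0 (by simp)
  have hY1 : Y i 1 = 0 := hY i 1 (by simp only [Fin.val_one]; omega)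
  rw [lie_X_apply]
  by_cases h1 : i = 1
  · subst h1
    have h2 : Y i2 k = 0 := hrows i2 k (by omega)
    simp [h01, h2, hY0, hY1]
  · simp [hi0, h1, hY0, hY1]

/-- The `ad X`-iterates have zero corner from the second one on (case `a ∉ {0, 1}`):
for `Y` with `Y 1 0 = Y 1 a = 0`, `((ad X)^{j+2} Y) 0 w = 0`. -/
theorem iter_lie_X_corner (a a1 w : Fin (n + 2)) (ha0 : a ≠ 0) (ha1 : a ≠ 1) (hw1 : w ≠ 1)
    (hwa : w ≠ a1) (Y : 𝕄) (h10 : Y 1 0 = 0) (h1a : Y 1 a = 0) (j : ℕ) :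
    ((fun Z : 𝕄 => ⁅(E K 0 1 + E K a a1 : 𝕄), Z⁆)^[j + 2] Y) 0 w = 0 := by
  -- row one vanishes from the first iterate on
  have hrow : ∀ j : ℕ, ∀ k : Fin (n + 2),
      ((fun Z : 𝕄 => ⁅(E K 0 1 + E K a a1 : 𝕄), Z⁆)^[j + 1] Y) 1 k = 0 := by
    intro j
    induction j with
    | zero =>
      intro k
      simp only [zero_add, Function.iterate_one]
      exact lie_X_row_one a a1 ha1 Y h10 h1a k
    | succ j ih =>
      intro k
      rw [Function.iterate_succ_apply']
      exact lie_X_row_one a a1 ha1 _ (ih 0) (ih a) k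
  rw [show j + 2 = (j + 1) + 1 from rfl, Function.iterate_succ_apply',
    lie_X_corner a a1 w ha0 hw1 hwa]
  exact hrow j w

/-- The `ad X`-iterates have zero corner from the second one on (case `a = 1`, `X = E 0 1 + E 1 2`):
for `Y` strictly upper triangular with zero rows `≥ 2`, `((ad X)^{j+2} Y) 0 w = 0` (`w ∉ {1, 2}`). -/
theorem iter_lie_X1_corner (i2 w : Fin (n + 2)) (hi2 : (i2 : ℕ) = 2) (hw1 : w ≠ 1) (hw2 : w ≠ i2)
    (Y : 𝕄) (hY : Drop 1 Y) (hrows : ∀ i k : Fin (n + 2), 2 ≤ (i : ℕ) → Y i k = 0) (j : ℕ) :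
    ((fun Z : 𝕄 => ⁅(E K 0 1 + E K 1 i2 : 𝕄), Z⁆)^[j + 2] Y) 0 w = 0 := by
  have hX : Drop 1 (E K 0 1 + E K 1 i2 : 𝕄) :=
    Drop.add (Drop_E (by simp)) (Drop_E (by simp only [Fin.val_one]; omega))
  -- invariant: strictly upper triangular with zero rows `≥ 1`, from the first iterate on
  have hinv : ∀ j : ℕ,
      Drop 1 ((fun Z : 𝕄 => ⁅(E K 0 1 + E K 1 i2 : 𝕄), Z⁆)^[j + 1] Y) ∧
      ∀ i k : Fin (n + 2), 1 ≤ (i : ℕ) →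
        ((fun Z : 𝕄 => ⁅(E K 0 1 + E K 1 i2 : 𝕄), Z⁆)^[j + 1] Y) i k = 0 := by
    intro j
    induction j with
    | zero =>
      simp only [zero_add, Function.iterate_one]
      exact ⟨(Drop.lie hX hY).mono (by norm_num),
        fun i k hi => lie_X1_rows i2 hi2 Y hY hrows i k hi⟩
    | succ j ih =>
      rw [Function.iterate_succ_apply']
      exact ⟨(Drop.lie hX ih.1).mono (by norm_num),
        fun i k hi => lie_X1_rows i2 hi2 _ ih.1 (fun i' k' hi' => ih.2 i' k' (by omega)) i k hi⟩
  have h10 : (1 : Fin (n + 2)) ≠ 0 := (Fin.zero_lt_one : (0 : Fin (n + 2)) < 1).ne'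
  rw [show j + 2 = (j + 1) + 1 from rfl, Function.iterate_succ_apply',
    lie_X_corner 1 i2 w h10 hw1 hw2]
  exact (hinv j).2 1 w (by simp)

end DepthTwo

end SoloBlind

end Summit.KontsevichZagierPeriods.KontsevichZagierPeriods.Theorems
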